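import Summits.ValiantsHypothesis.ValiantsHypothesis.Theorems.LacunarySymmetroidMatrixDescartesCensusDoorA34SheetDefiniteLetterCells
import Summits.ValiantsHypothesis.ValiantsHypothesis.Theorems.LacunarySymmetroidMatrixDescartesCensusDoorA34NullNullSheetDefiniteLetter

/-!
# `MatrixDescartes` census — DOOR A at `(3,4)`: the ADJUGATE-CELL DICHOTOMY of a singular symmetric letter (`det S = 0 ⇒ adj S ⪰ 0 ∨ −adj S ⪰ 0`), and the
# definite-letter laws on both null sheets WITHOUT any cell hypothesis

HONEST FRAMING.  Object-search cell `pub-symmetroid`, engine seat `val-sym-eng-2` (g4); helper rows beside the registered strata line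
`Cruxes/DoorA34/Lines/strata.lean` on stmt-ValiantsHypothesis-19980 (`DoorA34 = PosRootLawAt 3 4 18`: OPEN, typed, never asserted here).  The sheet laws of
…SheetDefiniteLetter / …SheetDefiniteLetterCells / …NullNullSheetDefiniteLetter take the ADJUGATE CELL of each singular end letter as a hypothesis
(`adj S ⪰ 0` or `−adj S ⪰ 0`).  This file discharges it for every real symmetric singular `3 × 3` letter:

* `quadForm_mul_diag_eq` — for symmetric `A` and each `k`: `(xᵀAx)·A_kk − ((Ax)_k)² = x_i²·adj A_jj − 2x_ix_j·adj A_ij + x_j²·adj A_ii` (`{i,j,k} = {0,1,2}`);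
* `posSemidef_or_neg_of_adjugate_eq_zero` — a symmetric `3 × 3` matrix with `adj A = 0` (all `2 × 2` minors vanish: rank `≤ 1`) is `⪰ 0` or `⪯ 0`;
* **`adjugate_cell_of_det_eq_zero`** — symmetric `S`, `det S = 0` ⇒ `adj S ⪰ 0 ∨ −adj S ⪰ 0` (`adj(adj S) = det S · S = 0`, Mathlib `adjugate_adjugate`);
* hence the hypothesis-free instances: **`card_posRoots_le_17_of_definite_lower_letter_on_0_4_9_16'`** (a null-top eighteen on `(0,4,9,16)` has THREE
  INDEFINITE lower letters), `…_on_0_6_20_29'`, `…_on_0_8_17_29'`, `…_on_0_10_22_38'`, and **`card_posRoots_le_16_of_definite_middle_letter_on_0_4_9_16'`**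
  (a null-null seventeen on `(0,4,9,16)` has both middle letters indefinite) — i.e. `stub_nullTopCeiling` / `stub_nullNullCeiling` HOLD on these supports
  for every symmetric pencil with a definite free letter.

Nothing here bounds anything on the all-indefinite residue; `DoorA34` and the three stubs stay OPEN; registers unchanged; nothing on `MatrixDescartes`
(stmt-ValiantsHypothesis-18050) or `VP ≠ VNP` — VP≠VNP not moved.  [folklore] `adj adj A = det A^{n−2} A`; a symmetric rank-one matrix is semidefinite; elementary.
-/

-- `Summit.ValiantsHypothesis.ValiantsHypothesis.…` repeats a component by the D-0017 layout
-- (single-conjunct summit), which the `dupNamespace` linter flags; the name is mandated.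
set_option linter.dupNamespace false

namespace Summit.ValiantsHypothesis.ValiantsHypothesis.Theorems.LacunarySymmetroidMatrixDescartes.Census

open Polynomial Finset Matrix
open scoped BigOperators Polynomial Matrix

/-- **Quadratic form times a diagonal entry, minus a square** (symmetric `3 × 3`, `k = 0`): `(xᵀAx)·A₀₀ − ((Ax)₀)² = x₁²·adjA₂₂ − 2x₁x₂·adjA₁₂ + x₂²·adjA₁₁`. [folklore] -/
theorem quadForm_mul_diag_eq_zero_row (A : Matrix (Fin 3) (Fin 3) ℝ) (hA : A.IsSymm) (x : Fin 3 → ℝ) :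
    (x ⬝ᵥ (A *ᵥ x)) * A 0 0 - (A *ᵥ x) 0 ^ 2
      = x 1 ^ 2 * A.adjugate 2 2 - 2 * x 1 * x 2 * A.adjugate 1 2 + x 2 ^ 2 * A.adjugate 1 1 := by
  have h10 : A 1 0 = A 0 1 := by simpa [Matrix.transpose_apply] using (congrFun (congrFun hA 1) 0).symm
  have h20 : A 2 0 = A 0 2 := by simpa [Matrix.transpose_apply] using (congrFun (congrFun hA 2) 0).symm
  have h21 : A 2 1 = A 1 2 := by simpa [Matrix.transpose_apply] using (congrFun (congrFun hA 2) 1).symm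
  simp [Matrix.adjugate_fin_three, Matrix.mulVec, dotProduct, Fin.sum_univ_three, h10, h20, h21]
  ring

/-- The same identity for `k = 1`: `(xᵀAx)·A₁₁ − ((Ax)₁)² = x₀²·adjA₂₂ − 2x₀x₂·adjA₀₂ + x₂²·adjA₀₀`. [folklore] -/
theorem quadForm_mul_diag_eq_one_row (A : Matrix (Fin 3) (Fin 3) ℝ) (hA : A.IsSymm) (x : Fin 3 → ℝ) :
    (x ⬝ᵥ (A *ᵥ x)) * A 1 1 - (A *ᵥ x) 1 ^ 2
      = x 0 ^ 2 * A.adjugate 2 2 - 2 * x 0 * x 2 * A.adjugate 0 2 + x 2 ^ 2 * A.adjugate 0 0 := by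
  have h10 : A 1 0 = A 0 1 := by simpa [Matrix.transpose_apply] using (congrFun (congrFun hA 1) 0).symm
  have h20 : A 2 0 = A 0 2 := by simpa [Matrix.transpose_apply] using (congrFun (congrFun hA 2) 0).symm
  have h21 : A 2 1 = A 1 2 := by simpa [Matrix.transpose_apply] using (congrFun (congrFun hA 2) 1).symm
  simp [Matrix.adjugate_fin_three, Matrix.mulVec, dotProduct, Fin.sum_univ_three, h10, h20, h21]
  ring

/-- The same identity for `k = 2`: `(xᵀAx)·A₂₂ − ((Ax)₂)² = x₀²·adjA₁₁ − 2x₀x₁·adjA₀₁ + x₁²·adjA₀₀`. [folklore] -/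
theorem quadForm_mul_diag_eq_two_row (A : Matrix (Fin 3) (Fin 3) ℝ) (hA : A.IsSymm) (x : Fin 3 → ℝ) :
    (x ⬝ᵥ (A *ᵥ x)) * A 2 2 - (A *ᵥ x) 2 ^ 2
      = x 0 ^ 2 * A.adjugate 1 1 - 2 * x 0 * x 1 * A.adjugate 0 1 + x 1 ^ 2 * A.adjugate 0 0 := by
  have h10 : A 1 0 = A 0 1 := by simpa [Matrix.transpose_apply] using (congrFun (congrFun hA 1) 0).symm
  have h20 : A 2 0 = A 0 2 := by simpa [Matrix.transpose_apply] using (congrFun (congrFun hA 2) 0).symm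
  have h21 : A 2 1 = A 1 2 := by simpa [Matrix.transpose_apply] using (congrFun (congrFun hA 2) 1).symm
  simp [Matrix.adjugate_fin_three, Matrix.mulVec, dotProduct, Fin.sum_univ_three, h10, h20, h21]
  ring

/-- **A symmetric `3 × 3` matrix with vanishing adjugate is semidefinite of one sign.** [folklore] -/
theorem posSemidef_or_neg_of_adjugate_eq_zero (A : Matrix (Fin 3) (Fin 3) ℝ) (hA : A.IsSymm) (h : A.adjugate = 0) :
    A.PosSemidef ∨ (-A).PosSemidef := by
  have hH : A.IsHermitian := Matrix.isHermitian_iff_isSymm.2 hA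
  have hHn : (-A).IsHermitian := hH.neg
  have hz : ∀ i j, A.adjugate i j = 0 := fun i j => by rw [h]; rfl
  -- the three quadratic identities with vanishing right-hand sides
  have q0 : ∀ x : Fin 3 → ℝ, (x ⬝ᵥ (A *ᵥ x)) * A 0 0 = (A *ᵥ x) 0 ^ 2 := fun x => by
    have := quadForm_mul_diag_eq_zero_row A hA x; rw [hz, hz, hz] at this; linarith
  have q1 : ∀ x : Fin 3 → ℝ, (x ⬝ᵥ (A *ᵥ x)) * A 1 1 = (A *ᵥ x) 1 ^ 2 := fun x => by
    have := quadForm_mul_diag_eq_one_row A hA x; rw [hz, hz, hz] at this; linarith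
  have q2 : ∀ x : Fin 3 → ℝ, (x ⬝ᵥ (A *ᵥ x)) * A 2 2 = (A *ᵥ x) 2 ^ 2 := fun x => by
    have := quadForm_mul_diag_eq_two_row A hA x; rw [hz, hz, hz] at this; linarith
  -- a positive diagonal entry gives `A ⪰ 0`, a negative one `−A ⪰ 0`
  have pos_case : ∀ k : Fin 3, (∀ x : Fin 3 → ℝ, (x ⬝ᵥ (A *ᵥ x)) * A k k = (A *ᵥ x) k ^ 2) → 0 < A k k → A.PosSemidef := by
    intro k qk hk
    refine Matrix.PosSemidef.of_dotProduct_mulVec_nonneg hH fun x => ?_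
    rw [star_trivial]
    have := qk x
    nlinarith [sq_nonneg ((A *ᵥ x) k)]
  have neg_case : ∀ k : Fin 3, (∀ x : Fin 3 → ℝ, (x ⬝ᵥ (A *ᵥ x)) * A k k = (A *ᵥ x) k ^ 2) → A k k < 0 → (-A).PosSemidef := by
    intro k qk hk
    refine Matrix.PosSemidef.of_dotProduct_mulVec_nonneg hHn fun x => ?_
    rw [star_trivial, Matrix.neg_mulVec, dotProduct_neg]
    have := qk x
    nlinarith [sq_nonneg ((A *ᵥ x) k)]
  rcases lt_trichotomy (A 0 0) 0 with h0 | h0 | h0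
  · exact Or.inr (neg_case 0 q0 h0)
  rotate_left
  · exact Or.inl (pos_case 0 q0 h0)
  rcases lt_trichotomy (A 1 1) 0 with h1 | h1 | h1
  · exact Or.inr (neg_case 1 q1 h1)
  rotate_left
  · exact Or.inl (pos_case 1 q1 h1)
  rcases lt_trichotomy (A 2 2) 0 with h2 | h2 | h2
  · exact Or.inr (neg_case 2 q2 h2)
  rotate_left
  · exact Or.inl (pos_case 2 q2 h2)
  -- all diagonal entries vanish: the principal minors (diagonal of `adj A`) force the off-diagonal entries to vanish, so `A = 0`
  have h10 : A 1 0 = A 0 1 := by simpa [Matrix.transpose_apply] using (congrFun (congrFun hA 1) 0).symm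
  have h20 : A 2 0 = A 0 2 := by simpa [Matrix.transpose_apply] using (congrFun (congrFun hA 2) 0).symm
  have h21 : A 2 1 = A 1 2 := by simpa [Matrix.transpose_apply] using (congrFun (congrFun hA 2) 1).symm
  have m22 := hz 2 2; have m11 := hz 1 1; have m00 := hz 0 0
  simp only [Matrix.adjugate_fin_three, Matrix.of_apply, Matrix.cons_val', Matrix.cons_val_zero, Matrix.cons_val_one,
    Matrix.cons_val_two, Matrix.empty_val', Matrix.cons_val_fin_one, Matrix.head_cons, Matrix.tail_cons, Matrix.head_fin_const,
    h10, h20, h21, h0, h1, h2] at m22 m11 m00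
  have a01 : A 0 1 = 0 := by nlinarith [sq_nonneg (A 0 1)]
  have a02 : A 0 2 = 0 := by nlinarith [sq_nonneg (A 0 2)]
  have a12 : A 1 2 = 0 := by nlinarith [sq_nonneg (A 1 2)]
  have hA0 : A = 0 := by
    ext i j
    fin_cases i <;> fin_cases j <;> simp [h0, h1, h2, h10, h20, h21, a01, a02, a12]
  left; rw [hA0]; exact Matrix.PosSemidef.zero

/-- **ADJUGATE-CELL DICHOTOMY.**  A real symmetric `3 × 3` letter with `det S = 0` has `adj S ⪰ 0` or `−adj S ⪰ 0` (`adj(adj S) = det S · S = 0`). [folklore] -/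
theorem adjugate_cell_of_det_eq_zero (S : Matrix (Fin 3) (Fin 3) ℝ) (hS : S.IsSymm) (h : S.det = 0) :
    S.adjugate.PosSemidef ∨ (-S.adjugate).PosSemidef := by
  refine posSemidef_or_neg_of_adjugate_eq_zero S.adjugate hS.adjugate ?_
  rw [Matrix.adjugate_adjugate _ (by simp), h]
  simp

/-! ## Hypothesis-free instances -/

/-- **`(0,4,9,16)`: a null-top eighteen has three INDEFINITE lower letters** — for every real symmetric pencil on `(0,4,9,16)` with a singular top letter
and a definite lower letter, `Z₊ ≤ 17` (no cell hypothesis). [folklore] -/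
theorem card_posRoots_le_17_of_definite_lower_letter_on_0_4_9_16' (S : Fin 4 → Matrix (Fin 3) (Fin 3) ℝ) (hS : ∀ l, (S l).IsSymm)
    (h3 : (S 3).det = 0) (a : Fin 4) (ha3 : a ≠ 3) (ha : (S a).PosDef ∨ (-S a).PosDef) :
    ((Matrix.det (∑ l, ((X : ℝ[X]) ^ ((![0, 4, 9, 16] : Fin 4 → ℕ)) l) • (S l).map C)).roots.toFinset.filter (fun t => 0 < t)).card
      ≤ 17 :=
  card_posRoots_le_17_of_definite_lower_letter_on_0_4_9_16 S hS h3 (adjugate_cell_of_det_eq_zero (S 3) (hS 3) h3) a ha3 ha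

/-- **`(0,6,20,29)`**: same statement (census bulk support). [folklore] -/
theorem card_posRoots_le_17_of_definite_lower_letter_on_0_6_20_29' (S : Fin 4 → Matrix (Fin 3) (Fin 3) ℝ) (hS : ∀ l, (S l).IsSymm)
    (h3 : (S 3).det = 0) (a : Fin 4) (ha3 : a ≠ 3) (ha : (S a).PosDef ∨ (-S a).PosDef) :
    ((Matrix.det (∑ l, ((X : ℝ[X]) ^ ((![0, 6, 20, 29] : Fin 4 → ℕ)) l) • (S l).map C)).roots.toFinset.filter (fun t => 0 < t)).card
      ≤ 17 :=
  card_posRoots_le_17_of_definite_lower_letter_on_0_6_20_29 S hS h3 (adjugate_cell_of_det_eq_zero (S 3) (hS 3) h3) a ha3 ha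

/-- **`(0,8,17,29)`**: same statement (census bulk support). [folklore] -/
theorem card_posRoots_le_17_of_definite_lower_letter_on_0_8_17_29' (S : Fin 4 → Matrix (Fin 3) (Fin 3) ℝ) (hS : ∀ l, (S l).IsSymm)
    (h3 : (S 3).det = 0) (a : Fin 4) (ha3 : a ≠ 3) (ha : (S a).PosDef ∨ (-S a).PosDef) :
    ((Matrix.det (∑ l, ((X : ℝ[X]) ^ ((![0, 8, 17, 29] : Fin 4 → ℕ)) l) • (S l).map C)).roots.toFinset.filter (fun t => 0 < t)).card
      ≤ 17 :=
  card_posRoots_le_17_of_definite_lower_letter_on_0_8_17_29 S hS h3 (adjugate_cell_of_det_eq_zero (S 3) (hS 3) h3) a ha3 ha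

/-- **`(0,10,22,38)`**: same statement (census bulk support). [folklore] -/
theorem card_posRoots_le_17_of_definite_lower_letter_on_0_10_22_38' (S : Fin 4 → Matrix (Fin 3) (Fin 3) ℝ) (hS : ∀ l, (S l).IsSymm)
    (h3 : (S 3).det = 0) (a : Fin 4) (ha3 : a ≠ 3) (ha : (S a).PosDef ∨ (-S a).PosDef) :
    ((Matrix.det (∑ l, ((X : ℝ[X]) ^ ((![0, 10, 22, 38] : Fin 4 → ℕ)) l) • (S l).map C)).roots.toFinset.filter (fun t => 0 < t)).card
      ≤ 17 :=
  card_posRoots_le_17_of_definite_lower_letter_on_0_10_22_38 S hS h3 (adjugate_cell_of_det_eq_zero (S 3) (hS 3) h3) a ha3 ha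

/-- **`(0,4,9,16)`, null-null sheet: a null-null seventeen has both MIDDLE letters indefinite** (no cell hypothesis). [folklore] -/
theorem card_posRoots_le_16_of_definite_middle_letter_on_0_4_9_16' (S : Fin 4 → Matrix (Fin 3) (Fin 3) ℝ) (hS : ∀ l, (S l).IsSymm)
    (h0 : (S 0).det = 0) (h3 : (S 3).det = 0) (a : Fin 4) (ha0 : a ≠ 0) (ha3 : a ≠ 3) (ha : (S a).PosDef ∨ (-S a).PosDef) :
    ((Matrix.det (∑ l, ((X : ℝ[X]) ^ ((![0, 4, 9, 16] : Fin 4 → ℕ)) l) • (S l).map C)).roots.toFinset.filter (fun t => 0 < t)).card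
      ≤ 16 :=
  card_posRoots_le_16_of_definite_middle_letter_on_0_4_9_16 S hS h0 h3 (adjugate_cell_of_det_eq_zero (S 0) (hS 0) h0)
    (adjugate_cell_of_det_eq_zero (S 3) (hS 3) h3) a ha0 ha3 ha

/-- **The sheet law without a cell hypothesis** (general sorted support): `det S₃ = 0`, a definite lower letter, and the test failing in BOTH adjugate cells ⇒ `≤ 17`. [folklore] -/
theorem card_posRoots_le_17_of_definite_lower_letter_bothCells (d : Fin 4 → ℕ) (hd : StrictMono d) (S : Fin 4 → Matrix (Fin 3) (Fin 3) ℝ)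
    (hS : ∀ l, (S l).IsSymm) (h3 : (S 3).det = 0) (a : Fin 4) (ha : (S a).PosDef ∨ (-S a).PosDef)
    (ρ : ℕ → ℕ) (hρ : ∀ e, ρ e = ((((Finset.univ : Finset (Sym (Fin 4) 3)).erase (Sym.replicate 3 3)).image
          (fun s : Sym (Fin 4) 3 => ((s : Multiset (Fin 4)).map d).sum)).filter (· < e)).card)
    (V : Fin 4 → Fin 4 → ℕ)
    (hV : ∀ x y : Fin 4, x ≠ y → V x y = (ρ (3 * d x) + ρ (2 * d x + d y)) % 2
        + (ρ (2 * d x + d y) + ρ (2 * d y + d x)) % 2 + (ρ (2 * d y + d x) + ρ (3 * d y)) % 2)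
    (W : Fin 4 → ℕ) (hW : ∀ x : Fin 4, W x = (ρ (3 * d x) + ρ (2 * d x + d 3)) % 2 + (ρ (2 * d x + d 3) + ρ (2 * d 3 + d x)) % 2)
    (htest : ∀ c : ℕ, (c = 0 ∨ c = 1) → ∀ σ : Fin 4 → SignType, σ a ≠ 0 →
        (∀ x y : Fin 4, x ≠ y → x ≠ 3 → y ≠ 3 → σ x ≠ 0 → σ y ≠ 0 → V x y = if σ x = σ y then 0 else 3) →
        (∀ x y : Fin 4, x ≠ y → x ≠ 3 → y ≠ 3 → σ x ≠ 0 → σ y = 0 → V x y ≠ 0 ∧ V x y ≠ 3) →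
        (∀ x : Fin 4, x ≠ 3 → σ x ≠ 0 → W x % 2 = c) → False) :
    ((Matrix.det (∑ l, ((X : ℝ[X]) ^ d l) • (S l).map C)).roots.toFinset.filter (fun t => 0 < t)).card ≤ 17 := by
  rcases adjugate_cell_of_det_eq_zero (S 3) (hS 3) h3 with hc | hc
  · exact card_posRoots_le_17_of_definite_lower_letter_sheet d hd S hS h3 0 (Or.inl ⟨hc, rfl⟩) a ha ρ hρ V hV W hW
      (htest 0 (Or.inl rfl))
  · exact card_posRoots_le_17_of_definite_lower_letter_sheet d hd S hS h3 1 (Or.inr ⟨hc, rfl⟩) a ha ρ hρ V hV W hW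
      (htest 1 (Or.inr rfl))

end Summit.ValiantsHypothesis.ValiantsHypothesis.Theorems.LacunarySymmetroidMatrixDescartes.Census
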